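import Literature.Analysis.FluidPDE.TaoAveragedRotationAveraging
import Literature.Analysis.FluidPDE.TaoAveragedGammaNormal
import Mathlib.Analysis.SpecialFunctions.Integrals.Basic
import HarnessLib

/-!
# Tao 2016, §3.8–§3.9 in spectral form: the fibre identity of the rotation averaging

T. Tao, *Finite time blowup for an averaged three-dimensional Navier–Stokes equation*,
J. Amer. Math. Soc. **29** (2016), 601–674 = arXiv:1402.0290v3, §3.8–§3.9 pp. 19–20.  Tao
writes `Yⱼ = R^{αⱼ}_{ηⱼ} n` (polar form in `ηⱼ^⊥`), observes that "each of the three coefficients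
of `R^{αⱼ}_{ηⱼ} n` is a complex linear combination of `e^{-iαⱼ}` and `e^{iαⱼ}`", expands
`Θ = Σ_σ c_σ e^{iσ·γ}` and inverts the Fourier series on `(ℝ/2πℤ)³` using the non-degeneracy
`c_σ ≠ 0` (3.24).  This file recasts those two pages as the *spectral decomposition* of the
complexified rotation `R^θ_ξ ⊗ 1` on `ℂ³` and the resulting **fibre identity**, in the exact form
consumed by the proof of `rotationAverage_jointWeight` (`TaoAveragedRotationAveraging.lean`):

* `frameW ξ n s = n - i s (u × n)` (`s = ±1`, `u = ξ/|ξ|`; twice the tree's `rotCoeff` vector) —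
  the isotropic eigenvectors: `(R^θ_ξ ⊗ 1) Wˢ = e^{isθ} Wˢ` (`rotMat_rodRotEquiv_frameW`),
  `Wˢ · Wˢ = 0`, `Wˢ · W⁻ˢ = 2`, `Wˢ · ξ = 0`;
* `specProj ξ n s` — the spectral projections `πˢ Y = ½ (Y · W⁻ˢ) Wˢ` and the decomposition
  `(R^θ_ξ ⊗ 1) Y = (Y·u) u + Σ_s e^{isθ} πˢ Y` of **every** `Y ∈ ℂ³`
  (`rotMat_rodRotEquiv_eq`; the axial part has frequency `0`);
* the characters on `[0, 2π]` (the tree's `intervalIntegral_exp_I_intCast_mul`) and the **extraction lemma**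
  `integral_torus_extract`: `∫_{[0,2π]³} e^{-iσ·θ} Λ((R^{θ₁}⊗1)Y₁, (R^{θ₂}⊗1)Y₂, (R^{θ₃}⊗1)Y₃) dθ
   = (2π)³ Λ(π^{σ₁}Y₁, π^{σ₂}Y₂, π^{σ₃}Y₃)` for all `Yⱼ ∈ ℂ³` (Fourier inversion on the torus,
  (3.23), with no orthogonality assumption on the `Yⱼ`);
* `lambdaSigma` — `λ_σ = Λ(W^{σ₁}_1, W^{σ₂}_2, W^{σ₃}_3) = 8 c_σ` (`lambdaSigma_eq_cSigma`, so
  `λ_σ ≠ 0` near (3.7) by `nondegeneracy_on_Gamma`, (3.24));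
* **the fibre identity** `fibre_synthesis`: with the weights
  `f_σ = λ_σ⁻¹ ∏ⱼ (W^{σⱼ}_j · cⱼ)` for vectors `cⱼ ⊥ ξⱼ`,
  `Σ_σ f_σ Λ(π^{σ₁}Y₁, π^{σ₂}Y₂, π^{σ₃}Y₃) = ∏ⱼ (Yⱼ · cⱼ)` for all `Yⱼ ∈ ℂ³` — this is (3.21)
  contracted against `c₁ ⊗ c₂ ⊗ c₃`, i.e. the statement that the rank-one tensor is synthesised
  from rotated copies of `Λ`.

## References

* T. Tao, J. Amer. Math. Soc. 29 (2016), 601–674, arXiv:1402.0290v3, §3.8 (3.21)–(3.23),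
  §3.9 (3.24), pp. 19–20. Key `Tao2016AveragedNS`.
-/

noncomputable section

open Real MeasureTheory intervalIntegral
open scoped RealInnerProductSpace ComplexConjugate

namespace Literature.Analysis.FluidPDE.Tao2016

/-- Local notation for physical / frequency space `ℝ³`. -/
local notation "ℝ³" => EuclideanSpace ℝ (Fin 3)
/-- Local notation for the complexified range `ℂ³`. -/
local notation "ℂ³" => EuclideanSpace ℂ (Fin 3)

open FunctionSpaces.EuclideanSpace (complexify complexify_apply)

/-! ### The isotropic frame `Wˢ = n - i s (u × n)` and the spectral projections -/

section Frame

variable {ξ n : ℝ³}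

/-- `cdot` is subtractive in its first argument. [folklore] -/
theorem cdot_sub_left (a b c : ℂ³) : cdot (a - b) c = cdot a c - cdot b c := by
  simp [cdot, sub_mul, Finset.sum_sub_distrib]

/-- `cdot` is subtractive in its second argument. [folklore] -/
theorem cdot_sub_right (a b c : ℂ³) : cdot a (b - c) = cdot a b - cdot a c := by
  simp [cdot, mul_sub, Finset.sum_sub_distrib]

/-- `X ⊥ u ⇒ X ⊥ ξ` for the unit axis `u = ξ/|ξ|`. [folklore] -/
theorem inner_eq_zero_of_inner_udir {X : ℝ³} (hξ : ξ ≠ 0) (h : ⟪X, udir ξ⟫ = 0) : ⟪X, ξ⟫ = 0 := by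
  have h1 := inner_udir_right X ξ
  rw [h] at h1
  exact (mul_eq_zero.mp h1.symm).resolve_left (inv_ne_zero (norm_ne_zero_iff.mpr hξ))

/-- `ξ ⊗ 1 = |ξ| (u ⊗ 1)` in `ℂ³`. [folklore] -/
theorem complexify_eq_norm_smul_udir (hξ : ξ ≠ 0) :
    (complexify ξ : ℂ³) = ((‖ξ‖ : ℝ) : ℂ) • complexify (udir ξ) := by
  have h : (complexify (udir ξ) : ℂ³) = ((‖ξ‖⁻¹ : ℝ) : ℂ) • complexify ξ := by
    rw [udir, map_smul]; rfl
  rw [h, smul_smul, ← Complex.ofReal_mul, mul_inv_cancel₀ (norm_ne_zero_iff.mpr hξ), Complex.ofReal_one,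
    one_smul]

/-- **The isotropic eigenvectors** `Wˢ = n - i s (u × n) ∈ ℂ³` (`s = ±1`, `u = ξ/|ξ|`) of the
rotations about `ξ` acting on `ℂ³` (twice the coefficient vectors `V^s` of the tree's
`rotCoeff`; §3.8: "each of the three coefficients of `R^{αⱼ}_{ηⱼ} n` is a complex linear
combination of `e^{-iαⱼ}` and `e^{iαⱼ}`"). [cite: Tao2016AveragedNS, §3.8 p. 19] -/
def frameW (ξ n : ℝ³) (s : ℤˣ) : ℂ³ :=
  complexify n - (Complex.I * ((s : ℤ) : ℂ)) • complexify (cross (udir ξ) n)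

/-- **The spectral projection** `πˢ Y = ½ (Y · W⁻ˢ) Wˢ` onto the `e^{isθ}`-eigenline. [cite: Tao2016AveragedNS, §3.8 p. 19] -/
def specProj (ξ n : ℝ³) (s : ℤˣ) (Y : ℂ³) : ℂ³ :=
  (cdot Y (frameW ξ n (-s)) / 2) • frameW ξ n s

/-- `(s : ℂ)² = 1` for `s = ±1`. [folklore] -/
theorem units_int_sq (s : ℤˣ) : (((s : ℤ) : ℂ)) ^ 2 = 1 := by
  rcases Int.units_eq_one_or s with h | h <;> simp [h]

/-- `(s : ℂ) * s = 1` for `s = ±1`. [folklore] -/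
theorem units_int_mul_self (s : ℤˣ) : ((s : ℤ) : ℂ) * ((s : ℤ) : ℂ) = 1 := by
  rw [← sq, units_int_sq]

/-- `((-s : ℤˣ) : ℂ) = -(s : ℂ)`. [folklore] -/
theorem units_int_neg (s : ℤˣ) : (((-s : ℤˣ) : ℤ) : ℂ) = -((s : ℤ) : ℂ) := by
  simp

/-- `cdot` with the complexified normal and conormal: the real Gram matrix of the frame
`(u, n, u × n)`. [folklore] -/
theorem frame_gram (hξ : ξ ≠ 0) (hn1 : ‖n‖ = 1) (hn : ⟪n, ξ⟫ = 0) :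
    ⟪n, n⟫ = 1 ∧ ⟪cross (udir ξ) n, cross (udir ξ) n⟫ = 1 ∧ ⟪n, cross (udir ξ) n⟫ = 0 ∧
      ⟪cross (udir ξ) n, n⟫ = 0 ∧ ⟪udir ξ, n⟫ = 0 ∧ ⟪n, udir ξ⟫ = 0 ∧ ⟪udir ξ, cross (udir ξ) n⟫ = 0 ∧
        ⟪cross (udir ξ) n, udir ξ⟫ = 0 ∧ ⟪udir ξ, udir ξ⟫ = 1 := by
  have hw1 : ‖cross (udir ξ) n‖ = 1 := norm_cross_udir_normal hξ hn1 hn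
  have hun : ⟪udir ξ, n⟫ = 0 := by rw [udir, real_inner_smul_left, real_inner_comm, hn, mul_zero]
  refine ⟨by rw [real_inner_self_eq_norm_sq, hn1, one_pow], by rw [real_inner_self_eq_norm_sq, hw1, one_pow],
    inner_self_cross_right _ _, inner_cross_self_right _ _, hun, by rw [real_inner_comm, hun],
    inner_self_cross_left _ _, inner_cross_self_left _ _, by rw [real_inner_self_eq_norm_sq, norm_udir hξ, one_pow]⟩

/-- **`Wˢ · Wᵗ = 1 - s t`**: the frame vectors are isotropic (`Wˢ · Wˢ = 0`) and dual
(`Wˢ · W⁻ˢ = 2`). [folklore] -/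
theorem cdot_frameW_frameW (hξ : ξ ≠ 0) (hn1 : ‖n‖ = 1) (hn : ⟪n, ξ⟫ = 0) (s t : ℤˣ) :
    cdot (frameW ξ n s) (frameW ξ n t) = 1 - ((s : ℤ) : ℂ) * ((t : ℤ) : ℂ) := by
  obtain ⟨hnn, hww, hnw, hwn, -, -, -, -, -⟩ := frame_gram hξ hn1 hn
  simp only [frameW, cdot_sub_left, cdot_sub_right, cdot_smul_left, cdot_smul_right, cdot_complexify, hnn, hww,
    hnw, hwn]
  push_cast
  have hI : Complex.I * Complex.I = -1 := Complex.I_mul_I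
  linear_combination (((s : ℤ) : ℂ) * ((t : ℤ) : ℂ)) * hI

/-- `Wˢ · Wˢ = 0`. [folklore] -/
theorem cdot_frameW_self (hξ : ξ ≠ 0) (hn1 : ‖n‖ = 1) (hn : ⟪n, ξ⟫ = 0) (s : ℤˣ) :
    cdot (frameW ξ n s) (frameW ξ n s) = 0 := by
  rw [cdot_frameW_frameW hξ hn1 hn, units_int_mul_self, sub_self]

/-- `Wˢ · W⁻ˢ = 2`. [folklore] -/
theorem cdot_frameW_neg (hξ : ξ ≠ 0) (hn1 : ‖n‖ = 1) (hn : ⟪n, ξ⟫ = 0) (s : ℤˣ) :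
    cdot (frameW ξ n s) (frameW ξ n (-s)) = 2 := by
  rw [cdot_frameW_frameW hξ hn1 hn, units_int_neg, mul_neg, units_int_mul_self]
  norm_num

/-- `W⁻ˢ · Wˢ = 2`. [folklore] -/
theorem cdot_frameW_neg' (hξ : ξ ≠ 0) (hn1 : ‖n‖ = 1) (hn : ⟪n, ξ⟫ = 0) (s : ℤˣ) :
    cdot (frameW ξ n (-s)) (frameW ξ n s) = 2 := by
  rw [cdot_frameW_frameW hξ hn1 hn, units_int_neg, neg_mul, units_int_mul_self]
  norm_num

/-- `Wˢ ⊥ ξ`: `u · Wˢ = 0` for the axis `u = ξ/|ξ|`. [folklore] -/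
theorem cdot_axis_frameW (hξ : ξ ≠ 0) (hn1 : ‖n‖ = 1) (hn : ⟪n, ξ⟫ = 0) (s : ℤˣ) :
    cdot (complexify (udir ξ)) (frameW ξ n s) = 0 := by
  obtain ⟨-, -, -, -, hun, -, huw, -, -⟩ := frame_gram hξ hn1 hn
  simp only [frameW, cdot_sub_right, cdot_smul_right, cdot_complexify, hun, huw]
  simp

/-- `Wˢ · u = 0`. [folklore] -/
theorem cdot_frameW_axis (hξ : ξ ≠ 0) (hn1 : ‖n‖ = 1) (hn : ⟪n, ξ⟫ = 0) (s : ℤˣ) :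
    cdot (frameW ξ n s) (complexify (udir ξ)) = 0 := by
  obtain ⟨-, -, -, -, -, hnu, -, hwu, -⟩ := frame_gram hξ hn1 hn
  simp only [frameW, cdot_sub_left, cdot_smul_left, cdot_complexify, hnu, hwu]
  simp

/-- `Wˢ · (c ξ) = 0` for any real multiple of the axis. [folklore] -/
theorem cdot_frameW_complexify_axis (hξ : ξ ≠ 0) (hn1 : ‖n‖ = 1) (hn : ⟪n, ξ⟫ = 0) (s : ℤˣ) :
    cdot (frameW ξ n s) (complexify ξ) = 0 := by
  rw [complexify_eq_norm_smul_udir hξ, cdot_smul_right, cdot_frameW_axis hξ hn1 hn, mul_zero]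

/-! ### The rotation `R^θ_ξ ⊗ 1` on the frame -/

/-- `R^θ_ξ n = cos θ n + sin θ (u × n)`. [folklore] -/
theorem rodRot_normal (hn : ⟪n, ξ⟫ = 0) (θ : ℝ) :
    rodRot ξ θ n = Real.cos θ • n + Real.sin θ • cross (udir ξ) n :=
  rodRot_of_inner_eq_zero hn θ

/-- `R^θ_ξ (u × n) = cos θ (u × n) - sin θ n` (`|u| = 1`, `n ⊥ ξ`). [folklore] -/
theorem rodRot_conormal (hξ : ξ ≠ 0) (hn : ⟪n, ξ⟫ = 0) (θ : ℝ) :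
    rodRot ξ θ (cross (udir ξ) n) = Real.cos θ • cross (udir ξ) n - Real.sin θ • n := by
  have hw : ⟪cross (udir ξ) n, ξ⟫ = 0 := inner_eq_zero_of_inner_udir hξ (inner_cross_self_left _ _)
  have hnu : ⟪n, udir ξ⟫ = 0 := by rw [udir, real_inner_smul_right, hn, mul_zero]
  rw [rodRot_of_inner_eq_zero hw, cross_cross_of_unit (norm_udir hξ) hnu, smul_neg, sub_eq_add_neg]

/-- **`Wˢ` is an eigenvector of `R^θ_ξ ⊗ 1` with eigenvalue `e^{isθ}`.** [cite: Tao2016AveragedNS, §3.8 p. 19] -/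
theorem rotMat_rodRotEquiv_frameW (hξ : ξ ≠ 0) (hn : ⟪n, ξ⟫ = 0) (θ : ℝ) (s : ℤˣ) :
    rotMat (rodRotEquiv hξ θ) (frameW ξ n s) =
      Complex.exp (Complex.I * ((s : ℤ) : ℂ) * (θ : ℂ)) • frameW ξ n s := by
  rw [frameW, map_sub, map_smul, rotMat_complexify, rotMat_complexify, rodRotEquiv_apply, rodRotEquiv_apply,
    rodRot_normal hn, rodRot_conormal hξ hn]
  simp only [map_add, map_sub, map_smul, smul_sub, smul_smul]
  -- compare coefficients of `n` and `u × n`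
  have hexp : Complex.exp (Complex.I * ((s : ℤ) : ℂ) * (θ : ℂ)) =
      (Real.cos θ : ℂ) + Complex.I * ((s : ℤ) : ℂ) * (Real.sin θ : ℂ) := by
    rcases Int.units_eq_one_or s with h | h
    · subst h
      push_cast
      rw [show Complex.I * (1 : ℂ) * (θ : ℂ) = (θ : ℂ) * Complex.I by ring, Complex.exp_mul_I]
      ring
    · subst h
      push_cast
      rw [show Complex.I * (-1 : ℂ) * (θ : ℂ) = (-(θ : ℂ)) * Complex.I by ring, Complex.exp_mul_I, Complex.cos_neg,
        Complex.sin_neg]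
      ring
  rw [hexp]
  have e1 : ∀ (a : ℝ) (v : ℂ³), a • v = (a : ℂ) • v := fun a v => rfl
  simp only [e1]
  have hs : ((s : ℤ) : ℂ) * ((s : ℤ) : ℂ) = 1 := units_int_mul_self s
  have hI : Complex.I * Complex.I = -1 := Complex.I_mul_I
  -- coefficients of `n ⊗ 1` and `(u × n) ⊗ 1`
  have c2 : ((Real.cos θ : ℂ) + Complex.I * ((s : ℤ) : ℂ) * (Real.sin θ : ℂ)) * (Complex.I * ((s : ℤ) : ℂ)) =
      -((Real.sin θ : ℂ) - Complex.I * ((s : ℤ) : ℂ) * (Real.cos θ : ℂ)) := by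
    linear_combination (Real.sin θ : ℂ) * hI + ((Real.sin θ : ℂ) * (Complex.I * Complex.I)) * hs
  rw [c2]
  module

/-- The axis is fixed: `(R^θ_ξ ⊗ 1)(ξ ⊗ 1) = ξ ⊗ 1`. [folklore] -/
theorem rotMat_rodRotEquiv_axis (hξ : ξ ≠ 0) (θ : ℝ) (c : ℝ) :
    rotMat (rodRotEquiv hξ θ) (complexify (c • ξ)) = complexify (c • ξ) := by
  rw [rotMat_complexify, rodRotEquiv_apply, rodRot_smul, rodRot_axis]

/-! ### The spectral decomposition of `ℂ³` and of `R^θ_ξ ⊗ 1` -/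

/-- Real vectors in the frame: `X = (X·u) u + (X·n) n + (X·(u×n)) (u×n)`. [folklore] -/
theorem real_frame_expansion (hξ : ξ ≠ 0) (hn1 : ‖n‖ = 1) (hn : ⟪n, ξ⟫ = 0) (X : ℝ³) :
    X = ⟪X, udir ξ⟫ • udir ξ + ⟪X, n⟫ • n + ⟪X, cross (udir ξ) n⟫ • cross (udir ξ) n := by
  obtain ⟨-, -, hnw, -, hun, hnu, huw, -, huu⟩ := frame_gram hξ hn1 hn
  set P := X - ⟪X, udir ξ⟫ • udir ξ with hP
  have hPu : ⟪P, udir ξ⟫ = 0 := by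
    rw [hP, inner_sub_left, real_inner_smul_left, huu, mul_one, sub_self]
  have hPξ : ⟪P, ξ⟫ = 0 := inner_eq_zero_of_inner_udir hξ hPu
  have hPexp := eq_inner_smul_add_of_inner_eq_zero hξ hn1 hn hPξ
  have hPn : ⟪P, n⟫ = ⟪X, n⟫ := by rw [hP, inner_sub_left, real_inner_smul_left, hun, mul_zero, sub_zero]
  have hPw : ⟪P, cross (udir ξ) n⟫ = ⟪X, cross (udir ξ) n⟫ := by
    rw [hP, inner_sub_left, real_inner_smul_left, huw, mul_zero, sub_zero]
  rw [hPn, hPw] at hPexp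
  calc X = ⟪X, udir ξ⟫ • udir ξ + P := by rw [hP]; abel
    _ = _ := by rw [hPexp, add_assoc]

/-- The sum of the two spectral projections is the projection onto `ξ^⊥ ⊗ ℂ`:
`Σ_s πˢ Y = (Y·n) n + (Y·(u×n)) (u×n)`. [folklore] -/
theorem sum_specProj (ξ n : ℝ³) (Y : ℂ³) :
    ∑ s : ℤˣ, specProj ξ n s Y =
      cdot Y (complexify n) • complexify n +
        cdot Y (complexify (cross (udir ξ) n)) • complexify (cross (udir ξ) n) := by
  rw [UnitsInt.univ, Finset.sum_pair (by decide : (1 : ℤˣ) ≠ -1)]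
  simp only [specProj, frameW, neg_neg, Units.val_one, Units.val_neg, Int.cast_one, Int.cast_neg, mul_one,
    mul_neg, neg_smul, sub_neg_eq_add, cdot_add_right, cdot_sub_right, cdot_smul_right, smul_add, smul_sub,
    smul_smul]
  have hI : Complex.I * Complex.I = -1 := Complex.I_mul_I
  have e2 : ∀ a b : ℂ, (a + Complex.I * b) / 2 * Complex.I = (Complex.I * a - b) / 2 := fun a b => by
    linear_combination (b / 2) * hI
  have e3 : ∀ a b : ℂ, (a - Complex.I * b) / 2 * Complex.I = (Complex.I * a + b) / 2 := fun a b => by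
    linear_combination (-(b / 2)) * hI
  rw [e2, e3]
  module

/-- **Spectral decomposition of `ℂ³`** along the axis `ξ` with normal `n`:
`Y = (Y·u) u + Σ_{s=±1} πˢ Y` for every `Y ∈ ℂ³`. [folklore] -/
theorem eq_axis_add_sum_specProj (hξ : ξ ≠ 0) (hn1 : ‖n‖ = 1) (hn : ⟪n, ξ⟫ = 0) (Y : ℂ³) :
    Y = cdot Y (complexify (udir ξ)) • complexify (udir ξ) + ∑ s : ℤˣ, specProj ξ n s Y := by
  rw [sum_specProj]
  -- real and imaginary parts
  conv_lhs => rw [← complexify_re_add_I_smul_complexify_im Y]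
  set Xr : ℝ³ := WithLp.toLp 2 fun j => (Y j).re
  set Xi : ℝ³ := WithLp.toLp 2 fun j => (Y j).im
  have hY : Y = complexify Xr + Complex.I • complexify Xi := (complexify_re_add_I_smul_complexify_im Y).symm
  have key : ∀ v : ℝ³, cdot Y (complexify v) = ((⟪Xr, v⟫ : ℝ) : ℂ) + Complex.I * ((⟪Xi, v⟫ : ℝ) : ℂ) := by
    intro v
    rw [hY, cdot_add_left, cdot_smul_left, cdot_complexify, cdot_complexify]
  rw [key, key, key]
  conv_lhs => rw [real_frame_expansion hξ hn1 hn Xr, real_frame_expansion hξ hn1 hn Xi]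
  simp only [map_add, map_smul]
  have e1 : ∀ (a : ℝ) (v : ℝ³), (a • complexify v : ℂ³) = (a : ℂ) • complexify v := fun a v => rfl
  simp only [e1, smul_add, smul_smul, add_smul]
  module

/-- **Spectral decomposition of the complexified rotation**: for every `Y ∈ ℂ³`,
`(R^θ_ξ ⊗ 1) Y = (Y·u) u + Σ_{s=±1} e^{isθ} πˢ Y` (the axial component has frequency `0`,
the two isotropic components have frequencies `±1`). [cite: Tao2016AveragedNS, §3.8 p. 19] -/
theorem rotMat_rodRotEquiv_eq (hξ : ξ ≠ 0) (hn1 : ‖n‖ = 1) (hn : ⟪n, ξ⟫ = 0) (θ : ℝ) (Y : ℂ³) :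
    rotMat (rodRotEquiv hξ θ) Y =
      cdot Y (complexify (udir ξ)) • complexify (udir ξ) +
        ∑ s : ℤˣ, Complex.exp (Complex.I * ((s : ℤ) : ℂ) * (θ : ℂ)) • specProj ξ n s Y := by
  conv_lhs => rw [eq_axis_add_sum_specProj hξ hn1 hn Y]
  rw [map_add, map_smul, map_sum]
  congr 1
  · rw [udir, rotMat_rodRotEquiv_axis hξ]
  · refine Finset.sum_congr rfl fun s _ => ?_
    rw [specProj, map_smul, rotMat_rodRotEquiv_frameW hξ hn θ s, smul_comm]

/-- `πˢ` in terms of the coefficient: `Λ`-relevant scalar `yˢ = ½ Y · W⁻ˢ`. [folklore] -/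
theorem specProj_eq (ξ n : ℝ³) (s : ℤˣ) (Y : ℂ³) :
    specProj ξ n s Y = (cdot Y (frameW ξ n (-s)) / 2) • frameW ξ n s := rfl

end Frame
/-! ### Characters on `[0, 2π]` and the one-dimensional extraction lemma -/

section Characters

/-- `∫₀^{2π} e^{-iσθ} e^{isθ} dθ = 2π [s = σ]` for signs `s, σ`. [folklore] -/
theorem integral_cexp_sign_sub (σ s : ℤˣ) :
    ∫ θ in (0 : ℝ)..2 * π, Complex.exp (-(Complex.I * ((σ : ℤ) : ℂ) * (θ : ℂ))) *
        Complex.exp (Complex.I * ((s : ℤ) : ℂ) * (θ : ℂ)) = if s = σ then 2 * (π : ℂ) else 0 := by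
  have h : ∀ θ : ℝ, Complex.exp (-(Complex.I * ((σ : ℤ) : ℂ) * (θ : ℂ))) *
      Complex.exp (Complex.I * ((s : ℤ) : ℂ) * (θ : ℂ)) =
      Complex.exp (Complex.I * (((s : ℤ) - (σ : ℤ) : ℤ) : ℂ) * (θ : ℂ)) := by
    intro θ
    rw [← Complex.exp_add]
    congr 1
    push_cast
    ring
  simp_rw [h]
  rw [intervalIntegral_exp_I_intCast_mul]
  by_cases hs : s = σ
  · subst hs; simp
  · rw [if_neg hs, if_neg]
    rw [sub_eq_zero]
    exact fun h' => hs (Units.ext h')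

/-- `∫₀^{2π} e^{-iσθ} dθ = 0` for a sign `σ`. [folklore] -/
theorem integral_cexp_neg_sign (σ : ℤˣ) :
    ∫ θ in (0 : ℝ)..2 * π, Complex.exp (-(Complex.I * ((σ : ℤ) : ℂ) * (θ : ℂ))) = 0 := by
  have h : ∀ θ : ℝ, Complex.exp (-(Complex.I * ((σ : ℤ) : ℂ) * (θ : ℂ))) =
      Complex.exp (Complex.I * (((-(σ : ℤ)) : ℤ) : ℂ) * (θ : ℂ)) := by
    intro θ; congr 1; push_cast; ring
  simp_rw [h]
  rw [intervalIntegral_exp_I_intCast_mul, if_neg]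
  simp

/-- **One-dimensional extraction**: for a trigonometric polynomial of degree one,
`∫₀^{2π} e^{-iσθ} (c₀ + Σ_{s=±1} e^{isθ} c_s) dθ = 2π c_σ`. [cite: Tao2016AveragedNS, §3.9 p. 20] -/
theorem integral_extract_one (σ : ℤˣ) (c₀ : ℂ) (c : ℤˣ → ℂ) :
    ∫ θ in (0 : ℝ)..2 * π, Complex.exp (-(Complex.I * ((σ : ℤ) : ℂ) * (θ : ℂ))) *
        (c₀ + ∑ s : ℤˣ, Complex.exp (Complex.I * ((s : ℤ) : ℂ) * (θ : ℂ)) * c s) = 2 * (π : ℂ) * c σ := by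
  have hcont : ∀ (k : ℂ), Continuous fun θ : ℝ => Complex.exp (k * (θ : ℂ)) := fun k => by fun_prop
  simp only [mul_add, Finset.mul_sum, ← mul_assoc]
  rw [intervalIntegral.integral_add, intervalIntegral.integral_mul_const, integral_cexp_neg_sign, zero_mul, zero_add,
    intervalIntegral.integral_finsetSum]
  · simp_rw [intervalIntegral.integral_mul_const, integral_cexp_sign_sub]
    simp only [ite_mul, zero_mul, Finset.sum_ite_eq', Finset.mem_univ, if_true]
  · intro s _
    exact ((Continuous.mul (by fun_prop) (by fun_prop)).mul continuous_const).intervalIntegrable _ _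
  · exact (Continuous.mul (by fun_prop) continuous_const).intervalIntegrable _ _
  · refine (continuous_finsetSum _ fun s _ => ?_).intervalIntegrable _ _
    exact (Continuous.mul (by fun_prop) (by fun_prop)).mul continuous_const

end Characters

/-! ### `Λ` is trilinear -/

section Trilinear

variable (ξ₁ ξ₂ : ℝ³)

/-- `cdot` is symmetric. [folklore] -/
theorem cdot_comm' (a b : ℂ³) : cdot a b = cdot b a := by
  simp [cdot, mul_comm]

/-- `Λ` is additive in the first slot. [folklore] -/
theorem Λ_add_fst (X X' Y Z : ℂ³) : Λ ξ₁ ξ₂ (X + X') Y Z = Λ ξ₁ ξ₂ X Y Z + Λ ξ₁ ξ₂ X' Y Z := by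
  simp only [Λ, cdot_add_left]; ring

/-- `Λ` is homogeneous in the first slot. [folklore] -/
theorem Λ_smul_fst (c : ℂ) (X Y Z : ℂ³) : Λ ξ₁ ξ₂ (c • X) Y Z = c * Λ ξ₁ ξ₂ X Y Z := by
  simp only [Λ, cdot_smul_left]; ring

/-- `Λ` is additive in the second slot. [folklore] -/
theorem Λ_add_snd (X Y Y' Z : ℂ³) : Λ ξ₁ ξ₂ X (Y + Y') Z = Λ ξ₁ ξ₂ X Y Z + Λ ξ₁ ξ₂ X Y' Z := by
  simp only [Λ, cdot_add_left]; ring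

/-- `Λ` is homogeneous in the second slot. [folklore] -/
theorem Λ_smul_snd (c : ℂ) (X Y Z : ℂ³) : Λ ξ₁ ξ₂ X (c • Y) Z = c * Λ ξ₁ ξ₂ X Y Z := by
  simp only [Λ, cdot_smul_left]; ring

/-- `Λ` is additive in the third slot. [folklore] -/
theorem Λ_add_thd (X Y Z Z' : ℂ³) : Λ ξ₁ ξ₂ X Y (Z + Z') = Λ ξ₁ ξ₂ X Y Z + Λ ξ₁ ξ₂ X Y Z' := by
  simp only [Λ, cdot_add_right]; ring

/-- `Λ` is homogeneous in the third slot. [folklore] -/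
theorem Λ_smul_thd (c : ℂ) (X Y Z : ℂ³) : Λ ξ₁ ξ₂ X Y (c • Z) = c * Λ ξ₁ ξ₂ X Y Z := by
  simp only [Λ, cdot_smul_right]; ring

/-- Sums over signs in the first slot. [folklore] -/
theorem Λ_sum_fst (f : ℤˣ → ℂ³) (Y Z : ℂ³) : Λ ξ₁ ξ₂ (∑ s, f s) Y Z = ∑ s, Λ ξ₁ ξ₂ (f s) Y Z := by
  rw [UnitsInt.univ, Finset.sum_pair (by decide : (1 : ℤˣ) ≠ -1), Finset.sum_pair (by decide : (1 : ℤˣ) ≠ -1),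
    Λ_add_fst]

/-- Sums over signs in the second slot. [folklore] -/
theorem Λ_sum_snd (X : ℂ³) (f : ℤˣ → ℂ³) (Z : ℂ³) : Λ ξ₁ ξ₂ X (∑ s, f s) Z = ∑ s, Λ ξ₁ ξ₂ X (f s) Z := by
  rw [UnitsInt.univ, Finset.sum_pair (by decide : (1 : ℤˣ) ≠ -1), Finset.sum_pair (by decide : (1 : ℤˣ) ≠ -1),
    Λ_add_snd]

/-- Sums over signs in the third slot. [folklore] -/
theorem Λ_sum_thd (X Y : ℂ³) (f : ℤˣ → ℂ³) : Λ ξ₁ ξ₂ X Y (∑ s, f s) = ∑ s, Λ ξ₁ ξ₂ X Y (f s) := by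
  rw [UnitsInt.univ, Finset.sum_pair (by decide : (1 : ℤˣ) ≠ -1), Finset.sum_pair (by decide : (1 : ℤˣ) ≠ -1),
    Λ_add_thd]

end Trilinear

/-! ### Fourier extraction on the torus ((3.23), for all `Yⱼ ∈ ℂ³`) -/

section Extraction

variable {ξ : Fin 3 → ℝ³} {n : ℝ³}

/-- `Λ` of a rotated first slot is a trigonometric polynomial of degree one in `θ`. [cite: Tao2016AveragedNS, §3.8 p. 19] -/
theorem Λ_rot_fst (hξ : ξ 0 ≠ 0) (hn1 : ‖n‖ = 1) (hn : ⟪n, ξ 0⟫ = 0) (θ : ℝ) (Y A B : ℂ³) :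
    Λ (ξ 0) (ξ 1) (rotMat (rodRotEquiv hξ θ) Y) A B =
      cdot Y (complexify (udir (ξ 0))) * Λ (ξ 0) (ξ 1) (complexify (udir (ξ 0))) A B +
        ∑ s : ℤˣ, Complex.exp (Complex.I * ((s : ℤ) : ℂ) * (θ : ℂ)) * Λ (ξ 0) (ξ 1) (specProj (ξ 0) n s Y) A B := by
  rw [rotMat_rodRotEquiv_eq hξ hn1 hn θ Y, Λ_add_fst, Λ_smul_fst, Λ_sum_fst]
  simp only [Λ_smul_fst]

/-- Same in the second slot. [cite: Tao2016AveragedNS, §3.8 p. 19] -/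
theorem Λ_rot_snd (hξ : ξ 1 ≠ 0) (hn1 : ‖n‖ = 1) (hn : ⟪n, ξ 1⟫ = 0) (θ : ℝ) (X Y B : ℂ³) :
    Λ (ξ 0) (ξ 1) X (rotMat (rodRotEquiv hξ θ) Y) B =
      cdot Y (complexify (udir (ξ 1))) * Λ (ξ 0) (ξ 1) X (complexify (udir (ξ 1))) B +
        ∑ s : ℤˣ, Complex.exp (Complex.I * ((s : ℤ) : ℂ) * (θ : ℂ)) * Λ (ξ 0) (ξ 1) X (specProj (ξ 1) n s Y) B := by
  rw [rotMat_rodRotEquiv_eq hξ hn1 hn θ Y, Λ_add_snd, Λ_smul_snd, Λ_sum_snd]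
  simp only [Λ_smul_snd]

/-- Same in the third slot. [cite: Tao2016AveragedNS, §3.8 p. 19] -/
theorem Λ_rot_thd (hξ : ξ 2 ≠ 0) (hn1 : ‖n‖ = 1) (hn : ⟪n, ξ 2⟫ = 0) (θ : ℝ) (X Y Z : ℂ³) :
    Λ (ξ 0) (ξ 1) X Y (rotMat (rodRotEquiv hξ θ) Z) =
      cdot Z (complexify (udir (ξ 2))) * Λ (ξ 0) (ξ 1) X Y (complexify (udir (ξ 2))) +
        ∑ s : ℤˣ, Complex.exp (Complex.I * ((s : ℤ) : ℂ) * (θ : ℂ)) * Λ (ξ 0) (ξ 1) X Y (specProj (ξ 2) n s Z) := by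
  rw [rotMat_rodRotEquiv_eq hξ hn1 hn θ Z, Λ_add_thd, Λ_smul_thd, Λ_sum_thd]
  simp only [Λ_smul_thd]

/-- **Fourier extraction on the torus** ((3.23) inverted): for every sign pattern `σ` and all
`Yⱼ ∈ ℂ³`,
`∫₀^{2π}∫₀^{2π}∫₀^{2π} e^{-i(σ₁θ₁+σ₂θ₂+σ₃θ₃)} Λ_ξ((R^{θ₁}_{ξ₁}⊗1)Y₁, (R^{θ₂}_{ξ₂}⊗1)Y₂, (R^{θ₃}_{ξ₃}⊗1)Y₃) dθ₁dθ₂dθ₃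
  = (2π)³ Λ_ξ(π^{σ₁}Y₁, π^{σ₂}Y₂, π^{σ₃}Y₃)`
(the axial components, of frequency `0`, are annihilated; no orthogonality of the `Yⱼ` to the
axes is assumed). [cite: Tao2016AveragedNS, §3.9 p. 20] -/
theorem integral_torus_extract (hξ : ∀ j, ξ j ≠ 0) (hn1 : ‖n‖ = 1) (hn : ∀ j, ⟪n, ξ j⟫ = 0)
    (σ : Fin 3 → ℤˣ) (Y : Fin 3 → ℂ³) :
    ∫ θ₃ in (0 : ℝ)..2 * π, ∫ θ₂ in (0 : ℝ)..2 * π, ∫ θ₁ in (0 : ℝ)..2 * π,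
      Complex.exp (-(Complex.I * ((σ 2 : ℤ) : ℂ) * (θ₃ : ℂ))) *
        (Complex.exp (-(Complex.I * ((σ 1 : ℤ) : ℂ) * (θ₂ : ℂ))) *
          (Complex.exp (-(Complex.I * ((σ 0 : ℤ) : ℂ) * (θ₁ : ℂ))) *
            Λ (ξ 0) (ξ 1) (rotMat (rodRotEquiv (hξ 0) θ₁) (Y 0)) (rotMat (rodRotEquiv (hξ 1) θ₂) (Y 1))
              (rotMat (rodRotEquiv (hξ 2) θ₃) (Y 2)))) =
      (2 * (π : ℂ)) ^ 3 * Λ (ξ 0) (ξ 1) (specProj (ξ 0) n (σ 0) (Y 0)) (specProj (ξ 1) n (σ 1) (Y 1))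
        (specProj (ξ 2) n (σ 2) (Y 2)) := by
  -- `θ₁`
  have h1 : ∀ θ₂ θ₃ : ℝ, (∫ θ₁ in (0 : ℝ)..2 * π, Complex.exp (-(Complex.I * ((σ 0 : ℤ) : ℂ) * (θ₁ : ℂ))) *
      Λ (ξ 0) (ξ 1) (rotMat (rodRotEquiv (hξ 0) θ₁) (Y 0)) (rotMat (rodRotEquiv (hξ 1) θ₂) (Y 1))
        (rotMat (rodRotEquiv (hξ 2) θ₃) (Y 2))) =
      2 * (π : ℂ) * Λ (ξ 0) (ξ 1) (specProj (ξ 0) n (σ 0) (Y 0)) (rotMat (rodRotEquiv (hξ 1) θ₂) (Y 1))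
        (rotMat (rodRotEquiv (hξ 2) θ₃) (Y 2)) := by
    intro θ₂ θ₃
    simp_rw [Λ_rot_fst (hξ 0) hn1 (hn 0)]
    exact integral_extract_one (σ 0) _ _
  simp_rw [intervalIntegral.integral_const_mul, h1]
  -- `θ₂`
  have h2 : ∀ θ₃ : ℝ, (∫ θ₂ in (0 : ℝ)..2 * π, Complex.exp (-(Complex.I * ((σ 1 : ℤ) : ℂ) * (θ₂ : ℂ))) *
      (2 * (π : ℂ) * Λ (ξ 0) (ξ 1) (specProj (ξ 0) n (σ 0) (Y 0)) (rotMat (rodRotEquiv (hξ 1) θ₂) (Y 1))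
        (rotMat (rodRotEquiv (hξ 2) θ₃) (Y 2)))) =
      (2 * (π : ℂ)) ^ 2 * Λ (ξ 0) (ξ 1) (specProj (ξ 0) n (σ 0) (Y 0)) (specProj (ξ 1) n (σ 1) (Y 1))
        (rotMat (rodRotEquiv (hξ 2) θ₃) (Y 2)) := by
    intro θ₃
    have e : ∀ θ₂ : ℝ, Complex.exp (-(Complex.I * ((σ 1 : ℤ) : ℂ) * (θ₂ : ℂ))) *
        (2 * (π : ℂ) * Λ (ξ 0) (ξ 1) (specProj (ξ 0) n (σ 0) (Y 0)) (rotMat (rodRotEquiv (hξ 1) θ₂) (Y 1))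
          (rotMat (rodRotEquiv (hξ 2) θ₃) (Y 2))) =
        2 * (π : ℂ) * (Complex.exp (-(Complex.I * ((σ 1 : ℤ) : ℂ) * (θ₂ : ℂ))) *
          Λ (ξ 0) (ξ 1) (specProj (ξ 0) n (σ 0) (Y 0)) (rotMat (rodRotEquiv (hξ 1) θ₂) (Y 1))
            (rotMat (rodRotEquiv (hξ 2) θ₃) (Y 2))) := fun θ₂ => by ring
    simp_rw [e, Λ_rot_snd (hξ 1) hn1 (hn 1)]
    rw [intervalIntegral.integral_const_mul, integral_extract_one (σ 1)]
    ring
  simp_rw [h2]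
  -- `θ₃`
  have e3 : ∀ θ₃ : ℝ, Complex.exp (-(Complex.I * ((σ 2 : ℤ) : ℂ) * (θ₃ : ℂ))) *
      ((2 * (π : ℂ)) ^ 2 * Λ (ξ 0) (ξ 1) (specProj (ξ 0) n (σ 0) (Y 0)) (specProj (ξ 1) n (σ 1) (Y 1))
        (rotMat (rodRotEquiv (hξ 2) θ₃) (Y 2))) =
      (2 * (π : ℂ)) ^ 2 * (Complex.exp (-(Complex.I * ((σ 2 : ℤ) : ℂ) * (θ₃ : ℂ))) *
        Λ (ξ 0) (ξ 1) (specProj (ξ 0) n (σ 0) (Y 0)) (specProj (ξ 1) n (σ 1) (Y 1))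
          (rotMat (rodRotEquiv (hξ 2) θ₃) (Y 2))) := fun θ₃ => by ring
  simp_rw [e3, Λ_rot_thd (hξ 2) hn1 (hn 2)]
  rw [intervalIntegral.integral_const_mul, integral_extract_one (σ 2)]
  ring

end Extraction

/-! ### `λ_σ = 8 c_σ` and the fibre synthesis -/

section Synthesis

variable {ξ : Fin 3 → ℝ³} {n : ℝ³}

/-- **`λ_σ = Λ_ξ(W^{σ₁}_1, W^{σ₂}_2, W^{σ₃}_3)`**, the value of `Λ` on the isotropic frame vectors
(`= 8 c_σ`, `lambdaSigma_eq_cSigma`). [cite: Tao2016AveragedNS, §3.9 p. 20] -/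
def lambdaSigma (ξ : Fin 3 → ℝ³) (n : ℝ³) (σ : Fin 3 → ℤˣ) : ℂ :=
  Λ (ξ 0) (ξ 1) (frameW (ξ 0) n (σ 0)) (frameW (ξ 1) n (σ 1)) (frameW (ξ 2) n (σ 2))

/-- **`λ_σ = 8 c_σ`**: the frame values of `Λ` are Tao's Fourier coefficients `c_σ` of `Θ` (§3.9,
display before "But by (3.17)") up to the factor `8 = 2³` (our `Wˢ` is twice Tao's `V^s`). [cite: Tao2016AveragedNS, §3.9 p. 20] -/
theorem lambdaSigma_eq_cSigma (hn1 : ‖n‖ = 1) (hn : ∀ j, ⟪n, ξ j⟫ = 0)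
    (σ : Fin 3 → ℤˣ) : lambdaSigma ξ n σ = 8 * cSigma ξ n σ := by
  have hnn : ⟪n, n⟫ = 1 := by rw [real_inner_self_eq_norm_sq, hn1, one_pow]
  have hun : ∀ j, ⟪udir (ξ j), n⟫ = 0 := fun j => by
    rw [udir, real_inner_smul_left, real_inner_comm, hn j, mul_zero]
  have hnu : ∀ j, ⟪n, udir (ξ j)⟫ = 0 := fun j => by rw [real_inner_comm, hun j]
  have hwn : ∀ j, ⟪cross (udir (ξ j)) n, n⟫ = 0 := fun j => inner_cross_self_right _ _
  have hnw : ∀ j, ⟪n, cross (udir (ξ j)) n⟫ = 0 := fun j => inner_self_cross_right _ _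
  have hww : ∀ j k, ⟪cross (udir (ξ j)) n, cross (udir (ξ k)) n⟫ = ⟪udir (ξ j), udir (ξ k)⟫ := fun j k => by
    rw [inner_cross_cross, hnn, hun, hnu]; ring
  simp only [lambdaSigma, Λ, frameW, cdot_sub_left, cdot_sub_right, cdot_smul_left, cdot_smul_right,
    cdot_complexify, hn, hnn, hwn, hnw, hww]
  rw [cSigma, one_div_eight_mul_I]
  push_cast
  have hI : Complex.I * Complex.I = -1 := Complex.I_mul_I
  linear_combination (-(((σ 0 : ℤ) : ℂ) * (⟪cross (udir (ξ 0)) n, ξ 1⟫ : ℂ) *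
    (((σ 1 : ℤ) : ℂ) * ((σ 2 : ℤ) : ℂ) * (⟪udir (ξ 1), udir (ξ 2)⟫ : ℂ)) +
    ((σ 1 : ℤ) : ℂ) * (⟪cross (udir (ξ 1)) n, ξ 0⟫ : ℂ) *
      (((σ 0 : ℤ) : ℂ) * ((σ 2 : ℤ) : ℂ) * (⟪udir (ξ 0), udir (ξ 2)⟫ : ℂ)))) * Complex.I * hI

/-- `Λ` of the three spectral projections: `Λ(π^{σ₁}Y₁, π^{σ₂}Y₂, π^{σ₃}Y₃) = (∏ⱼ yⱼ^{σⱼ}) λ_σ`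
with `yⱼˢ = ½ Yⱼ · W⁻ˢⱼ`. [folklore] -/
theorem Λ_specProj (σ : Fin 3 → ℤˣ) (Y : Fin 3 → ℂ³) :
    Λ (ξ 0) (ξ 1) (specProj (ξ 0) n (σ 0) (Y 0)) (specProj (ξ 1) n (σ 1) (Y 1)) (specProj (ξ 2) n (σ 2) (Y 2)) =
      (∏ j, cdot (Y j) (frameW (ξ j) n (-σ j)) / 2) * lambdaSigma ξ n σ := by
  simp only [specProj, Λ_smul_fst, Λ_smul_snd, Λ_smul_thd, lambdaSigma, Fin.prod_univ_three]
  ring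

/-- The sum of `(Wˢ · c) (½ Y · W⁻ˢ)` over `s` is `Y · c` when `c ⊥ ξ`. [folklore] -/
theorem sum_cdot_frameW_mul {ζ : ℝ³} (hζ : ζ ≠ 0) (hn1 : ‖n‖ = 1) (hn : ⟪n, ζ⟫ = 0) (Y c : ℂ³)
    (hc : cdot c (complexify (udir ζ)) = 0) :
    ∑ s : ℤˣ, cdot (frameW ζ n s) c * (cdot Y (frameW ζ n (-s)) / 2) = cdot Y c := by
  have h : ∑ s : ℤˣ, cdot (frameW ζ n s) c * (cdot Y (frameW ζ n (-s)) / 2) =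
      cdot (∑ s : ℤˣ, specProj ζ n s Y) c := by
    rw [UnitsInt.univ, Finset.sum_pair (by decide : (1 : ℤˣ) ≠ -1), Finset.sum_pair (by decide : (1 : ℤˣ) ≠ -1),
      cdot_add_left, specProj, specProj, cdot_smul_left, cdot_smul_left]
    ring
  rw [h]
  have hY := eq_axis_add_sum_specProj hζ hn1 hn Y
  have : ∑ s : ℤˣ, specProj ζ n s Y = Y - cdot Y (complexify (udir ζ)) • complexify (udir ζ) := by
    rw [eq_sub_iff_add_eq, add_comm, ← hY]
  rw [this, cdot_sub_left, cdot_smul_left, cdot_comm' (complexify (udir ζ)) c, hc, mul_zero, sub_zero]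

/-- **The fibre synthesis** ((3.21) contracted against `c₁ ⊗ c₂ ⊗ c₃`): if `λ_σ ≠ 0` for all `σ` and
`cⱼ ⊥ ξⱼ`, then with the weights `f_σ = λ_σ⁻¹ ∏ⱼ (W^{σⱼ}ⱼ · cⱼ)`,
`Σ_σ f_σ Λ_ξ(π^{σ₁}Y₁, π^{σ₂}Y₂, π^{σ₃}Y₃) = ∏ⱼ (Yⱼ · cⱼ)` for all `Yⱼ ∈ ℂ³`: the rank-one
trilinear form `Y ↦ ∏ⱼ (Yⱼ·cⱼ)` is synthesised from the spectral pieces of `Λ`. [cite: Tao2016AveragedNS, §3.7–3.8 (3.20)–(3.21) p. 19] -/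
theorem fibre_synthesis (hξ : ∀ j, ξ j ≠ 0) (hn1 : ‖n‖ = 1) (hn : ∀ j, ⟪n, ξ j⟫ = 0)
    (hnd : ∀ σ, lambdaSigma ξ n σ ≠ 0) (Y c : Fin 3 → ℂ³) (hc : ∀ j, cdot (c j) (complexify (udir (ξ j))) = 0) :
    ∑ σ : Fin 3 → ℤˣ, (lambdaSigma ξ n σ)⁻¹ * (∏ j, cdot (frameW (ξ j) n (σ j)) (c j)) *
        Λ (ξ 0) (ξ 1) (specProj (ξ 0) n (σ 0) (Y 0)) (specProj (ξ 1) n (σ 1) (Y 1))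
          (specProj (ξ 2) n (σ 2) (Y 2)) = ∏ j, cdot (Y j) (c j) := by
  have hterm : ∀ σ : Fin 3 → ℤˣ, (lambdaSigma ξ n σ)⁻¹ * (∏ j, cdot (frameW (ξ j) n (σ j)) (c j)) *
      Λ (ξ 0) (ξ 1) (specProj (ξ 0) n (σ 0) (Y 0)) (specProj (ξ 1) n (σ 1) (Y 1)) (specProj (ξ 2) n (σ 2) (Y 2)) =
      ∏ j, cdot (frameW (ξ j) n (σ j)) (c j) * (cdot (Y j) (frameW (ξ j) n (-σ j)) / 2) := by
    intro σ
    rw [Λ_specProj, Finset.prod_mul_distrib]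
    field_simp [hnd σ]
  simp_rw [hterm]
  have hps : (∑ σ : Fin 3 → ℤˣ, ∏ j, cdot (frameW (ξ j) n (σ j)) (c j) * (cdot (Y j) (frameW (ξ j) n (-σ j)) / 2)) =
      ∏ j, ∑ s : ℤˣ, cdot (frameW (ξ j) n s) (c j) * (cdot (Y j) (frameW (ξ j) n (-s)) / 2) := by
    rw [Finset.prod_univ_sum]
    simp only [Fintype.piFinset_univ]
  rw [hps]
  exact Finset.prod_congr rfl fun j _ => sum_cdot_frameW_mul (hξ j) hn1 (hn j) (Y j) (c j) (hc j)

/-- **Non-degeneracy of the fibre synthesis near (3.7)** ((3.24) transported to `λ_σ`): there is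
`δ > 0` such that for every closed triangle `η` (`η₁ + η₂ + η₃ = 0`) with `|ηⱼ - ξⱼ⁰| ≤ δ`, the
`ηⱼ` are non-zero and non-collinear, `n(η)` (`gammaNormal`) is a unit normal of the `ηⱼ`, and
`λ_σ(η, n(η)) ≠ 0` for all eight sign patterns `σ`. [cite: Tao2016AveragedNS, §3.9 (3.24) p. 20] -/
theorem lambdaSigma_ne_zero_near_xi0 : ∃ δ : ℝ, 0 < δ ∧ ∀ η : Fin 3 → ℝ³, (∀ j, ‖η j - xi0 j‖ ≤ δ) →
    η 0 + η 1 + η 2 = 0 →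
      (∀ j, η j ≠ 0) ∧ cross (η 0) (η 1) ≠ 0 ∧ ‖gammaNormal η‖ = 1 ∧
        (∀ j, ⟪gammaNormal η, η j⟫ = 0) ∧ ∀ σ, lambdaSigma η (gammaNormal η) σ ≠ 0 := by
  obtain ⟨δ, hδ, h⟩ := nondegeneracy_on_Gamma
  refine ⟨δ, hδ, fun η hη hsum => ?_⟩
  obtain ⟨hne, hcr, hn1, hn, hc⟩ := h η hη hsum
  refine ⟨hne, hcr, hn1, hn, fun σ => ?_⟩
  rw [lambdaSigma_eq_cSigma hn1 hn]
  exact mul_ne_zero (by norm_num) (hc σ)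

end Synthesis
end Literature.Analysis.FluidPDE.Tao2016
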